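import Literature.MathematicalPhysics.QuantumFieldTheory.BalabanImbrieJaffe1984to88.BIJ88Ineq5144TwoCube
import Literature.MathematicalPhysics.QuantumFieldTheory.BalabanImbrieJaffe1984to88.BIJ88Ineq5144LocatedSlots

/-!
# `BalabanImbrieJaffe1984to88.BIJ88Ineq5144TwoCubeLeaf` — T. Bałaban, J. Imbrie, A. Jaffe, *Effective action and cluster properties of the abelian
Higgs model*, Commun. Math. Phys. **114** (1988) 257–315 [BalabanImbrieJaffe1988], Sect. 5.14, (5.14.4) p. 309 [PDF 53]: **THE TYPED LEAF (5.14.4)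
BY NAME, LOCATED READING, FROM ITS PART ON `|X_β| ≥ 3` — AND INHABITED FOR A COUPLED PRECISION ON TWO ABUTTING CUBES** (kernel certificate with
a uniform threshold); companion of `BIJ88Ineq5144TwoCube` (p36 gen 17: `|X_β| = 2` for any coupling), `BIJ88SlotFieldGaussBounds` (gen 16: `|X_β| = 1`
from structural data), `BIJ88Ineq5144LocatedSlots` (gen 16: the leaf by name for BLOCK-DIAGONAL `Δ`).

statement-level skeleton of published theorems with citation tags; proofs where landed; nothing here is a claim about the Yang–Mills mass gap

PDF held: `paper:balaban1988-cmp114-bij-abelian-higgs-effective-action` (journal page = PDF page + 256); p. 309 = PDF 53 read as an x2 render this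
generation.  p. 309, verbatim: *"Here H_β ⊂ H specifies which (d/dt)_{γ_j} have supports intersecting X_β. … Let us drop the prime, and prove that
|g₃(H_β, X_β)| ≦ (e^β(L^kε/ε₀)^{1/4−α})^{[|H_β| + β′|X_β∖H_β|]}. (5.14.4) We use X_β∖H_β to denote the set of cubes with no (d/dt)_{γ_j} factors,
j ∈ H_β. The proof of this estimate is similar to the one for g₂."*

WHAT IS PROVED (unit `lit-balaban-p36`, generation 17 of the Phase-2 proof seat p36; SKELETON row **C2.Eq5.14.3-5.14.4** member cell of
`HOME/lit-balaban-r16/ROWS-C2-part2.md`, owner r16 — an OWNER HEAD CHECK is invited: the leaf is inhabited by name for NON-block-diagonal data, but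
only on a two-cube world; row C2.Eq5.14.5 xref).
* §1 **`ineq5144_locAct_of_three_le_struct`** — for the §5.13 data of a region `X` at `(Λ, t, γ)` with ANY coupling `Δ ≻ 0`, r16's typed leaf
  `BIJ88Sect5StatementsPart2.Ineq5144 (cubeSys I) (Finset L) (locAct (cubeIn ∘ γ) (actIn … Λ X t γ)) card (H X″ ↦ |X″ ∖ loc H|) θ β′` FOLLOWS from
  its part on the polymers with `≥ 3` cubes, in the joint regime of gen 16's one-cube theorem (`ineq5144_locAct_singleton_of_struct`) and gen 17's
  two-cube theorem (`ineq5144_locAct_pair_of_struct`, with its declared adjustment `θ ↦ θ^{1+β′}/2` of the per-derivative factor); the empty polymer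
  carries no activity (`BIJ88Ineq5144LocatedSlots.actIn_empty_right`).  **`ineq5144_locAct_of_card_le_two_struct`**: on a cube set with
  `Fintype.card I ≤ 2` the `≥ 3` part is vacuous — THE LEAF BY NAME FOR ANY COUPLING.
* §2 **`ineq5144_locAct_fin2_coupled_uniform`** — KERNEL CERTIFICATE WITH A THRESHOLD CHOSEN BEFORE THE DATUM: for `p > 1/2`, `n₀` there is
  `e₀ > 0` such that for every `e_k ∈ (0, e₀)`, every abutting relation on `Fin 2`, every corner `Λ`, region `X`, `t ∈ (0,1]`, `|L| ≤ n₀`, `γ`, the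
  data «sites = cubes = `Fin 2`, the COUPLED precision `Δ = !![2, 1; 1, 2]` (`fin2Coupling_apply_offDiag`: `Δ 0 1 = 1 ≠ 0`), `ℱ = 0`, one linear
  χ-slot per cube (the site field), `c ≡ 1`, no interaction terms, `χ = gevreyCutoff`» satisfy the typed leaf BY NAME with `θ = e_k^{1/4}`,
  `β′ = 1` (`m = Λ = 1`, `F = 0`, `G = 1`, `K₁ = 0`; `Δ = 1 + AᴴA` with `A` the all-ones row, `fin2Coupling_eq`, so `Δ ≻ 0` and `Δ ≥ 1·1` by Mathlib's
  `Matrix.PosDef.one.add_posSemidef`/`posSemidef_conjTranspose_mul_self`).  The first inhabitation of `Ineq5144` for COUPLED data in the tree.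
HONEST SCOPE: a two-cube world has no polymer with `≥ 3` cubes, so NOTHING of the inductive cluster-expansion decay (print: *"similar to the one
for g₂"*) is exercised; the two-cube activities are controlled by twice the one-law estimates (gen 17), not by the join mechanism of p. 307; the head
of row C2.Eq5.14.3-5.14.4 stays the owner's call.  0 `sorry`, 0 definitions, 0 `Prop` facts (D-0026); imports `BIJ88Ineq5144TwoCube` (p36 g17) and
`BIJ88Ineq5144LocatedSlots` (p36 g16); modifies nothing.  NOT summit progress; NOT continuum; NOT Clay.  Cell `lit-balaban` Phase 2, seat p36 gen 17
(owner r16, referee ref-5).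
-/

noncomputable section

open Finset MeasureTheory ProbabilityTheory Matrix Filter
open Literature.MathematicalPhysics.QuantumFieldTheory.BalabanImbrieJaffe1984to88
open BIJ88Sect2Statements (pLog)
open BIJ88Sect5Statements (CutoffProfile cutoff)
open BIJ88DirichletForms305 (interpForm)
open BIJ88PolymerRep5134 (corner)
open BIJ88PolymerRep5134Gauss (ext src)
open BIJ88Eq5145CornerModel (slotB slotY)
open BIJ88Eq5145CornerUrsell (cubeIn)
open BIJ88W6PrimeVsupp (actIn)
open BIJ88Ineq5144Located (locAct locAct_eq_zero_of_eq_zero)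
open BIJ88Ineq5113Covering (cubeSys)
open BIJ88Sect5StatementsPart2 (Ineq5144)
open BIJ88GaussIntegration309Product (exists_const_all_orders)
open BIJ88CutoffProfileWitness (gevreyCutoff chi1_nonneg)
open BIJ88SmallChargeRegime (exists_threshold eventually_const_le_mul_log_rpow eventually_const_mul_le_one eventually_le_one)
open BIJ88SlotFieldGaussBounds (ineq5144_locAct_singleton_of_struct)
open BIJ88Ineq5144LocatedSlots (actIn_empty_right)
open BIJ88Ineq5144TwoCube (ineq5144_locAct_pair_of_struct)

namespace Literature.MathematicalPhysics.QuantumFieldTheory.BalabanImbrieJaffe1984to88.BIJ88Ineq5144TwoCubeLeaf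

/-! ## §1 The located leaf by name from its part on the polymers with at least three cubes -/

section Model

variable {α I : Type} [Fintype α] [DecidableEq α] [Fintype I] [DecidableEq I]
  (blk : α → I) (Δ : Matrix α α ℝ) (ℱ : α → ℝ)
variable (adj : I → I → Prop) [DecidableRel adj]
variable (χ : CutoffProfile) {ι υ : Type*} [DecidableEq ι] [DecidableEq υ]
variable {p ek : ℝ} {B : Finset ι} {Φ : ι → (α → ℝ) → ℝ} {c : ι → ℝ} {Ys : Finset υ} {V : υ → (α → ℝ) → ℝ}
variable (cube : ↥B ⊕ ↥Ys → I)

/-- **THE TYPED LEAF (5.14.4) BY NAME, LOCATED READING, FOR ANY COUPLING `Δ ≻ 0`, FROM ITS PART ON `|X_β| ≥ 3`** (p. 309 (5.14.4)):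
`Ineq5144 (cubeSys I) (Finset L) (locAct (cubeIn ∘ γ) (actIn … Λ X t γ)) card (H X″ ↦ |X″ ∖ loc H|) θ β′` for the data of the region `X` at
`(Λ, t, γ)` — the empty polymer carries no activity, the one-cube polymers by gen 16's `ineq5144_locAct_singleton_of_struct`, the two-cube polymers
by gen 17's `ineq5144_locAct_pair_of_struct`, the rest is the hypothesis `h3`.  Hypotheses: the union of the one-cube regime (tail constant
`A = 4e^{F²/(2m)}`, weight `e^{GK₁}`: `Ĉ^{n₀}Ae^{GK₁}e_k ≤ 1`, `K_Y e^{GK₁} ≤ θ`, `e^{GK₁}GAe_k + (e^{GK₁} − 1) ≤ θ^{β′}`, `e_k ≤ θ`) and the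
two-cube regime (`A₂ = 4e^{F²/m}`, weight `e^{2GK₁}`: `Ĉ^{n₀}A₂e^{2GK₁}e_k ≤ 1`, `e^{2GK₁}·2G·A₂·e_k + (e^{2GK₁} − 1) ≤ θ^{2β′}/2`, and the ADJUSTED
per-derivative factor `e_k ≤ θ^{1+β′}/2`, `K_Y e^{2GK₁} ≤ θ^{1+β′}/2` — see `BIJ88Ineq5144TwoCube`), structural data `Δ ≥ m·1`, `|ℓ_jφ| ≤ Λ‖φ‖₂`,
`‖ℱ|_□‖₂ ≤ F`, `≤ G` slots per cube. [cite: BalabanImbrieJaffe1988, (5.14.4) p.309; p.307 (Sect. 5.13)] -/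
theorem ineq5144_locAct_of_three_le_struct [Fintype ι] [Fintype υ] (hp : 1 / 2 < p) {n₀ : ℕ} {C : ℝ} (hC1 : 1 ≤ C)
    (hC : ∀ i, i ≤ n₀ → ∀ (A : ℝ) ⦃q e t : ℝ⦄, q ≠ 0 → 0 < e → 0 < t → t * e ≤ Real.exp (-1) →
      |iteratedDeriv i (fun s => cutoff χ (q * pLog p (s * e)) A) t| ≤ C * t ^ (-(i : ℤ)))
    (hΔ : Δ.PosDef) {m : ℝ} (hm : 0 < m) (hΔm : ∀ φ : α → ℝ, m * (φ ⬝ᵥ φ) ≤ φ ⬝ᵥ (Δ *ᵥ φ))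
    (hχ : ∀ x, 0 ≤ χ.χ₁ x) {c₀ : ℝ} (hc₀ : 0 < c₀) (hcb : ∀ b ∈ B, c₀ ≤ c b) {Λ : ℝ} (hΛ : 0 < Λ)
    (hmod : ∀ b ∈ B, ∃ ℓ₁ ℓ₂ : (α → ℝ) → ℝ, IsLinearMap ℝ ℓ₁ ∧ IsLinearMap ℝ ℓ₂ ∧
      ((∀ φ, Φ b φ = ℓ₁ φ) ∨ (∀ φ, Φ b φ = Real.sqrt (ℓ₁ φ ^ 2 + ℓ₂ φ ^ 2))) ∧
      (∀ φ, |ℓ₁ φ| ≤ Λ * Real.sqrt (φ ⬝ᵥ φ)) ∧ (∀ φ, |ℓ₂ φ| ≤ Λ * Real.sqrt (φ ⬝ᵥ φ)))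
    {F : ℝ} (hF0 : 0 ≤ F) (hF : ∀ i : I, src blk ℱ {i} ⬝ᵥ src blk ℱ {i} ≤ F ^ 2)
    (hV : ∀ Y ∈ Ys, Measurable (V Y)) {KY : υ → ℝ} (hK : ∀ Y ∈ Ys, ∀ φ, |V Y φ| ≤ KY Y)
    {K₁ : ℝ} (hK₁0 : 0 ≤ K₁) (hK₁ : ∀ Y ∈ Ys, KY Y ≤ K₁) {G : ℕ} (hG : ∀ i, (univ.filter fun τ : ↥B ⊕ ↥Ys => cube τ = i).card ≤ G)
    (hek : 0 < ek) (hek1 : ek ≤ Real.exp (-1)) {θ β' : ℝ} (hθ1 : θ ≤ 1) (hβ : 0 ≤ β') (hekθ : ek ≤ θ)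
    (hreg : (n₀ : ℝ) + 1 ≤ m / (8 * Λ ^ 2) * (81 / 100) * c₀ ^ 2 * Real.log ek⁻¹ ^ (2 * p - 1))
    -- the one-cube regime (gen 16)
    (hpre : C ^ n₀ * (4 * Real.exp (F ^ 2 / (2 * m))) * Real.exp (G * K₁) * ek ≤ 1) (hKθ : ∀ Y ∈ Ys, KY Y * Real.exp (G * K₁) ≤ θ)
    (hvac : Real.exp (G * K₁) * G * (4 * Real.exp (F ^ 2 / (2 * m))) * ek + (Real.exp (G * K₁) - 1) ≤ θ ^ β')
    -- the two-cube regime (gen 17)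
    (hpre₂ : C ^ n₀ * (4 * Real.exp (F ^ 2 / m)) * Real.exp (2 * G * K₁) * ek ≤ 1)
    (hvac₂ : Real.exp (2 * G * K₁) * (2 * G) * (4 * Real.exp (F ^ 2 / m)) * ek + (Real.exp (2 * G * K₁) - 1) ≤ θ ^ (2 * β') / 2)
    (hekθ₂ : ek ≤ θ ^ (1 + β') / 2) (hKθ₂ : ∀ Y ∈ Ys, KY Y * Real.exp (2 * G * K₁) ≤ θ ^ (1 + β') / 2)
    (Λ' X : Finset I) {t : ℝ} (ht : t ∈ Set.Ioc (0 : ℝ) 1) {L : Type} [Fintype L] [DecidableEq L] (hL : Fintype.card L ≤ n₀)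
    (γ : L → ↥(slotB B Ys cube X) ⊕ ↥(slotY B Ys cube X))
    (h3 : ∀ (H : Finset L) (X₃ : Finset I), 3 ≤ X₃.card →
      |locAct (cubeIn cube X ∘ γ) (actIn blk Δ ℱ adj χ p ek B Φ c Ys V cube Λ' X t γ) H X₃| ≤
        θ ^ ((H.card : ℝ) + β' * ((X₃ \ H.image (cubeIn cube X ∘ γ)).card : ℝ))) :
    Ineq5144 (cubeSys I) (Finset L) (locAct (cubeIn cube X ∘ γ) (actIn blk Δ ℱ adj χ p ek B Φ c Ys V cube Λ' X t γ))
      Finset.card (fun H (X'' : Finset I) => (X'' \ H.image (cubeIn cube X ∘ γ)).card) θ β' := by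
  rintro H (X'' : Finset I)
  have hθ0 : 0 < θ := hek.trans_le hekθ
  rcases Nat.lt_or_ge X''.card 3 with hlt | hge
  · rcases Nat.lt_trichotomy X''.card 1 with h0 | h1 | h2
    · rw [card_eq_zero.1 (show X''.card = 0 by omega), locAct_eq_zero_of_eq_zero (actIn_empty_right blk Δ ℱ adj χ cube Λ' X t γ H),
        abs_zero]
      exact Real.rpow_nonneg hθ0.le _
    · exact ineq5144_locAct_singleton_of_struct blk Δ ℱ adj χ cube hp hC1 hC hΔ hm hΔm hχ hc₀ hcb hΛ hmod hF0 hF hV hK hK₁0 hK₁ hG hek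
        hek1 hekθ hreg hpre hKθ hvac Λ' X ht hL γ H X'' h1
    · exact ineq5144_locAct_pair_of_struct blk Δ ℱ adj χ cube hp hC1 hC hΔ hm hΔm hχ hc₀ hcb hΛ hmod hF0 hF hV hK hK₁0 hK₁ hG hek hek1
        hθ0 hθ1 hβ hreg hpre₂ hvac₂ hekθ₂ hKθ₂ Λ' X ht hL γ H X'' (by omega)
  · exact h3 H X'' hge

/-- **ON A CUBE SET WITH AT MOST TWO CUBES THE LEAF HOLDS BY NAME FOR ANY COUPLING** (no polymer has three cubes).
[cite: BalabanImbrieJaffe1988, (5.14.4) p.309] -/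
theorem ineq5144_locAct_of_card_le_two_struct [Fintype ι] [Fintype υ] (hI : Fintype.card I ≤ 2) (hp : 1 / 2 < p) {n₀ : ℕ} {C : ℝ}
    (hC1 : 1 ≤ C)
    (hC : ∀ i, i ≤ n₀ → ∀ (A : ℝ) ⦃q e t : ℝ⦄, q ≠ 0 → 0 < e → 0 < t → t * e ≤ Real.exp (-1) →
      |iteratedDeriv i (fun s => cutoff χ (q * pLog p (s * e)) A) t| ≤ C * t ^ (-(i : ℤ)))
    (hΔ : Δ.PosDef) {m : ℝ} (hm : 0 < m) (hΔm : ∀ φ : α → ℝ, m * (φ ⬝ᵥ φ) ≤ φ ⬝ᵥ (Δ *ᵥ φ))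
    (hχ : ∀ x, 0 ≤ χ.χ₁ x) {c₀ : ℝ} (hc₀ : 0 < c₀) (hcb : ∀ b ∈ B, c₀ ≤ c b) {Λ : ℝ} (hΛ : 0 < Λ)
    (hmod : ∀ b ∈ B, ∃ ℓ₁ ℓ₂ : (α → ℝ) → ℝ, IsLinearMap ℝ ℓ₁ ∧ IsLinearMap ℝ ℓ₂ ∧
      ((∀ φ, Φ b φ = ℓ₁ φ) ∨ (∀ φ, Φ b φ = Real.sqrt (ℓ₁ φ ^ 2 + ℓ₂ φ ^ 2))) ∧
      (∀ φ, |ℓ₁ φ| ≤ Λ * Real.sqrt (φ ⬝ᵥ φ)) ∧ (∀ φ, |ℓ₂ φ| ≤ Λ * Real.sqrt (φ ⬝ᵥ φ)))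
    {F : ℝ} (hF0 : 0 ≤ F) (hF : ∀ i : I, src blk ℱ {i} ⬝ᵥ src blk ℱ {i} ≤ F ^ 2)
    (hV : ∀ Y ∈ Ys, Measurable (V Y)) {KY : υ → ℝ} (hK : ∀ Y ∈ Ys, ∀ φ, |V Y φ| ≤ KY Y)
    {K₁ : ℝ} (hK₁0 : 0 ≤ K₁) (hK₁ : ∀ Y ∈ Ys, KY Y ≤ K₁) {G : ℕ} (hG : ∀ i, (univ.filter fun τ : ↥B ⊕ ↥Ys => cube τ = i).card ≤ G)
    (hek : 0 < ek) (hek1 : ek ≤ Real.exp (-1)) {θ β' : ℝ} (hθ1 : θ ≤ 1) (hβ : 0 ≤ β') (hekθ : ek ≤ θ)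
    (hreg : (n₀ : ℝ) + 1 ≤ m / (8 * Λ ^ 2) * (81 / 100) * c₀ ^ 2 * Real.log ek⁻¹ ^ (2 * p - 1))
    (hpre : C ^ n₀ * (4 * Real.exp (F ^ 2 / (2 * m))) * Real.exp (G * K₁) * ek ≤ 1) (hKθ : ∀ Y ∈ Ys, KY Y * Real.exp (G * K₁) ≤ θ)
    (hvac : Real.exp (G * K₁) * G * (4 * Real.exp (F ^ 2 / (2 * m))) * ek + (Real.exp (G * K₁) - 1) ≤ θ ^ β')
    (hpre₂ : C ^ n₀ * (4 * Real.exp (F ^ 2 / m)) * Real.exp (2 * G * K₁) * ek ≤ 1)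
    (hvac₂ : Real.exp (2 * G * K₁) * (2 * G) * (4 * Real.exp (F ^ 2 / m)) * ek + (Real.exp (2 * G * K₁) - 1) ≤ θ ^ (2 * β') / 2)
    (hekθ₂ : ek ≤ θ ^ (1 + β') / 2) (hKθ₂ : ∀ Y ∈ Ys, KY Y * Real.exp (2 * G * K₁) ≤ θ ^ (1 + β') / 2)
    (Λ' X : Finset I) {t : ℝ} (ht : t ∈ Set.Ioc (0 : ℝ) 1) {L : Type} [Fintype L] [DecidableEq L] (hL : Fintype.card L ≤ n₀)
    (γ : L → ↥(slotB B Ys cube X) ⊕ ↥(slotY B Ys cube X)) :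
    Ineq5144 (cubeSys I) (Finset L) (locAct (cubeIn cube X ∘ γ) (actIn blk Δ ℱ adj χ p ek B Φ c Ys V cube Λ' X t γ))
      Finset.card (fun H (X'' : Finset I) => (X'' \ H.image (cubeIn cube X ∘ γ)).card) θ β' :=
  ineq5144_locAct_of_three_le_struct blk Δ ℱ adj χ cube hp hC1 hC hΔ hm hΔm hχ hc₀ hcb hΛ hmod hF0 hF hV hK hK₁0 hK₁ hG hek hek1 hθ1 hβ
    hekθ hreg hpre hKθ hvac hpre₂ hvac₂ hekθ₂ hKθ₂ Λ' X ht hL γ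
    (fun H X₃ h3 => absurd ((card_le_univ X₃).trans hI) (by omega))

end Model

/-! ## §2 A coupled precision on two abutting cubes: the leaf by name, uniform threshold -/

section Fin2

/-- the coupled precision of the certificate is `1 + AᴴA`, `A` the all-ones row (so `≻ 0` and `≥ 1·1`). [cite: BalabanImbrieJaffe1988, p.305 (Sect. 5.13)] -/
theorem fin2Coupling_eq : (!![2, 1; 1, 2] : Matrix (Fin 2) (Fin 2) ℝ) =
    1 + (Matrix.of fun (_ : Unit) (_ : Fin 2) => (1 : ℝ))ᴴ * Matrix.of fun (_ : Unit) (_ : Fin 2) => (1 : ℝ) := by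
  ext i j
  fin_cases i <;> fin_cases j <;> simp [Matrix.mul_apply] <;> norm_num

/-- **the precision IS coupled**: its off-diagonal entry between the two cubes is `1 ≠ 0`. [cite: BalabanImbrieJaffe1988, p.305 (Sect. 5.13)] -/
theorem fin2Coupling_apply_offDiag : (!![2, 1; 1, 2] : Matrix (Fin 2) (Fin 2) ℝ) 0 1 = 1 := by simp

/-- positive definiteness and the form bound `≥ 1·1` of the coupled precision. [cite: BalabanImbrieJaffe1988, p.305 (Sect. 5.13)] -/
theorem fin2Coupling_posDef_and_ge :
    (!![2, 1; 1, 2] : Matrix (Fin 2) (Fin 2) ℝ).PosDef ∧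
      ∀ φ : Fin 2 → ℝ, 1 * (φ ⬝ᵥ φ) ≤ φ ⬝ᵥ ((!![2, 1; 1, 2] : Matrix (Fin 2) (Fin 2) ℝ) *ᵥ φ) := by
  have hS := Matrix.posSemidef_conjTranspose_mul_self (Matrix.of fun (_ : Unit) (_ : Fin 2) => (1 : ℝ))
  rw [fin2Coupling_eq]
  refine ⟨Matrix.PosDef.one.add_posSemidef hS, fun φ => ?_⟩
  rw [Matrix.add_mulVec, dotProduct_add, Matrix.one_mulVec, one_mul]
  have h := hS.dotProduct_mulVec_nonneg φ
  rw [star_trivial] at h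
  linarith

/-- **KERNEL CERTIFICATE — THE TYPED LEAF (5.14.4) BY NAME FOR A COUPLED PRECISION, THRESHOLD BEFORE THE DATUM**: for `p > 1/2` and `n₀`
there is `e₀ > 0` such that for every abutting relation on `Fin 2`, every cube map of the form `Sum.inl b ↦ b`, every `e_k ∈ (0, e₀)`, corner `Λ`,
region `X`, `t ∈ (0,1]`, `|L| ≤ n₀`, assignment `γ`, the data «sites = cubes = `Fin 2`, precision `!![2, 1; 1, 2]` (COUPLED), `ℱ = 0`, one linear
χ-slot per cube (the site field), `c ≡ 1`, no interaction terms, `χ = gevreyCutoff`» satisfy `Ineq5144 (cubeSys (Fin 2)) (Finset L) (locAct … (actIn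
…)) card (…) (e_k^{1/4}) 1` — every hypothesis of `ineq5144_locAct_of_card_le_two_struct` discharged: `m = Λ = 1`, `F = 0`, `G = 1`, `K₁ = 0`,
`c₀ = 1`, the all-orders constant `Ĉ(gevreyCutoff, p, n₀)`, and the regime inequalities `n₀ + 1 ≤ (81/800)|log e_k⁻¹|^{2p−1}`, `e·e_k ≤ 1`,
`Ĉ^{n₀}·4·e_k ≤ 1`, `256 e_k ≤ 1`, `e_k ≤ 1` (`BIJ88SmallChargeRegime.exists_threshold`). [cite: BalabanImbrieJaffe1988, (5.14.4) p.309; p.307 (Sect. 5.13)] -/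
theorem ineq5144_locAct_fin2_coupled_uniform {p : ℝ} (hp : 1 / 2 < p) (n₀ : ℕ) :
    ∃ e₀ : ℝ, 0 < e₀ ∧ ∀ (adj : Fin 2 → Fin 2 → Prop) [DecidableRel adj]
      {cube : ↥(univ : Finset (Fin 2)) ⊕ ↥(∅ : Finset (Fin 2)) → Fin 2} (_ : ∀ b, cube (Sum.inl b) = b.1) ⦃e : ℝ⦄, 0 < e → e < e₀ →
      ∀ (Λ X : Finset (Fin 2)) {t : ℝ} (_ : t ∈ Set.Ioc (0 : ℝ) 1) {L : Type} [Fintype L] [DecidableEq L] (_ : Fintype.card L ≤ n₀)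
        (γ : L → ↥(slotB (univ : Finset (Fin 2)) (∅ : Finset (Fin 2)) cube X) ⊕ ↥(slotY (univ : Finset (Fin 2)) (∅ : Finset (Fin 2)) cube X)),
        Ineq5144 (cubeSys (Fin 2)) (Finset L)
          (locAct (cubeIn cube X ∘ γ)
            (actIn (id : Fin 2 → Fin 2) (!![2, 1; 1, 2] : Matrix (Fin 2) (Fin 2) ℝ) (0 : Fin 2 → ℝ) adj gevreyCutoff p e
              (univ : Finset (Fin 2)) (fun (i : Fin 2) (φ : Fin 2 → ℝ) => φ i) (fun _ => (1 : ℝ)) (∅ : Finset (Fin 2))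
              (fun (_ : Fin 2) (_ : Fin 2 → ℝ) => (0 : ℝ)) cube Λ X t γ))
          Finset.card (fun H (X'' : Finset (Fin 2)) => (X'' \ H.image (cubeIn cube X ∘ γ)).card) (Real.sqrt (Real.sqrt e)) 1 := by
  classical
  obtain ⟨C, hC1, hC⟩ := exists_const_all_orders gevreyCutoff p n₀
  have hκ0 : 0 < 1 / (8 * (1 : ℝ) ^ 2) * (81 / 100) * (1 : ℝ) ^ 2 := by positivity
  -- the `e_k`-small regime: five conditions eventually, the threshold BEFORE the datum
  obtain ⟨δ, hδ, hreg⟩ := exists_threshold (Q := fun x : ℝ =>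
      ((n₀ : ℝ) + 1 ≤ 1 / (8 * (1 : ℝ) ^ 2) * (81 / 100) * (1 : ℝ) ^ 2 * Real.log x⁻¹ ^ (2 * p - 1)) ∧ Real.exp 1 * x ≤ 1 ∧
        C ^ n₀ * 4 * x ≤ 1 ∧ 256 * x ≤ 1 ∧ x ≤ 1) (by
    filter_upwards [eventually_const_le_mul_log_rpow ((n₀ : ℝ) + 1) _ (2 * p - 1) hκ0 (by linarith),
      eventually_const_mul_le_one (Real.exp 1), eventually_const_mul_le_one (C ^ n₀ * 4), eventually_const_mul_le_one 256,
      eventually_le_one] with x h1 h2 h3 h4 h5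
    exact ⟨h1, h2, h3, h4, h5⟩)
  refine ⟨δ, hδ, ?_⟩
  intro adj _ cube hcube e he heδ Λ X t ht L _ _ hL γ
  obtain ⟨h1, h2, h3, h4, h5⟩ := hreg e he heδ
  -- elementary consequences of the regime (`θ = e^{1/4} = √√e`)
  have he1 : e ≤ Real.exp (-1) := by
    have hpos := Real.exp_pos 1
    calc e = Real.exp 1 * e / Real.exp 1 := by field_simp
      _ ≤ 1 / Real.exp 1 := by gcongr
      _ = Real.exp (-1) := by rw [Real.exp_neg, one_div]
  set s : ℝ := Real.sqrt e with hs
  set θ : ℝ := Real.sqrt s with hθ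
  have hs0 : 0 < s := Real.sqrt_pos.2 he
  have hθ0 : 0 < θ := Real.sqrt_pos.2 hs0
  have hss : s * s = e := Real.mul_self_sqrt he.le
  have hθθ : θ * θ = s := Real.mul_self_sqrt hs0.le
  have hs16 : s ≤ 1 / 16 := by
    have h16 : e ≤ (1 / 16) ^ 2 := by nlinarith
    calc s ≤ Real.sqrt ((1 / 16) ^ 2) := Real.sqrt_le_sqrt h16
      _ = 1 / 16 := Real.sqrt_sq (by norm_num)
  have hs1 : s ≤ 1 := by linarith
  have hθ1 : θ ≤ 1 := by rw [hθ, ← Real.sqrt_one]; exact Real.sqrt_le_sqrt hs1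
  have hes : e ≤ s := by nlinarith
  have hsθ : s ≤ θ := by nlinarith
  have hθsq : θ ^ ((1 : ℝ) + 1) = s := by rw [show (1 : ℝ) + 1 = (2 : ℕ) by norm_num, Real.rpow_natCast, pow_two, hθθ]
  have hθsq' : θ ^ ((2 : ℝ) * 1) = s := by rw [mul_one, show (2 : ℝ) = (2 : ℕ) by norm_num, Real.rpow_natCast, pow_two, hθθ]
  -- the structural data: `Δ = !![2,1;1,2] ≥ 1·1`, slot fields = coordinates (`Λ = 1`), `ℱ = 0` (`F = 0`), one slot per cube
  obtain ⟨hΔ, hΔm⟩ := fin2Coupling_posDef_and_ge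
  have hlin : ∀ i : Fin 2, IsLinearMap ℝ (fun φ : Fin 2 → ℝ => φ i) := fun i => (LinearMap.proj (R := ℝ) (φ := fun _ : Fin 2 => ℝ) i).isLinear
  have hΛ : ∀ (i : Fin 2) (φ : Fin 2 → ℝ), |φ i| ≤ 1 * Real.sqrt (φ ⬝ᵥ φ) := fun i φ => by
    rw [one_mul]
    refine Real.abs_le_sqrt ?_
    rw [pow_two]
    exact Finset.single_le_sum (f := fun j => φ j * φ j) (fun j _ => mul_self_nonneg (φ j)) (mem_univ i)
  have hF : ∀ i : Fin 2, src (id : Fin 2 → Fin 2) (0 : Fin 2 → ℝ) {i} ⬝ᵥ src (id : Fin 2 → Fin 2) (0 : Fin 2 → ℝ) {i} ≤ (0 : ℝ) ^ 2 :=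
    fun i => by simp [BIJ88PolymerRep5134Gauss.src, dotProduct]
  have hG : ∀ i : Fin 2, (univ.filter fun τ : ↥(univ : Finset (Fin 2)) ⊕ ↥(∅ : Finset (Fin 2)) => cube τ = i).card ≤ 1 := fun i =>
    card_le_one.2 fun a ha b hb => by
      obtain ⟨-, ha⟩ := mem_filter.1 ha
      obtain ⟨-, hb⟩ := mem_filter.1 hb
      rcases a with a | a
      · rcases b with b | b
        · rw [hcube] at ha hb
          rw [Subtype.ext (ha.trans hb.symm)]
        · exact absurd b.2 (notMem_empty _)
      · exact absurd a.2 (notMem_empty _)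
  -- the regime inequalities (`G = 1`, `K₁ = 0`, `m = Λ = 1`, `F = 0`, `θ = e^{1/4}`, `β′ = 1`)
  have hA1 : (4 * Real.exp ((0 : ℝ) ^ 2 / (2 * 1))) = 4 := by simp
  have hA2 : (4 * Real.exp ((0 : ℝ) ^ 2 / 1)) = 4 := by simp
  have hW1 : Real.exp (((1 : ℕ) : ℝ) * 0) = 1 := by simp
  have hW2 : Real.exp (2 * ((1 : ℕ) : ℝ) * 0) = 1 := by simp
  have hpre : C ^ n₀ * (4 * Real.exp ((0 : ℝ) ^ 2 / (2 * 1))) * Real.exp (((1 : ℕ) : ℝ) * 0) * e ≤ 1 := by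
    rw [hA1, hW1, mul_one]; exact h3
  have hpre₂ : C ^ n₀ * (4 * Real.exp ((0 : ℝ) ^ 2 / 1)) * Real.exp (2 * ((1 : ℕ) : ℝ) * 0) * e ≤ 1 := by
    rw [hA2, hW2, mul_one]; exact h3
  have hvac : Real.exp (((1 : ℕ) : ℝ) * 0) * ((1 : ℕ) : ℝ) * (4 * Real.exp ((0 : ℝ) ^ 2 / (2 * 1))) * e + (Real.exp (((1 : ℕ) : ℝ) * 0) - 1) ≤
      θ ^ (1 : ℝ) := by
    rw [hA1, hW1, Real.rpow_one]
    norm_num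
    nlinarith
  have hvac₂ : Real.exp (2 * ((1 : ℕ) : ℝ) * 0) * (2 * ((1 : ℕ) : ℝ)) * (4 * Real.exp ((0 : ℝ) ^ 2 / 1)) * e +
      (Real.exp (2 * ((1 : ℕ) : ℝ) * 0) - 1) ≤ θ ^ ((2 : ℝ) * 1) / 2 := by
    rw [hA2, hW2, hθsq']
    norm_num
    nlinarith
  have hekθ₂ : e ≤ θ ^ ((1 : ℝ) + 1) / 2 := by rw [hθsq]; nlinarith
  have hreg' : (n₀ : ℝ) + 1 ≤ 1 / (8 * (1 : ℝ) ^ 2) * (81 / 100) * (1 : ℝ) ^ 2 * Real.log e⁻¹ ^ (2 * p - 1) := h1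
  exact ineq5144_locAct_of_card_le_two_struct (id : Fin 2 → Fin 2) _ (0 : Fin 2 → ℝ) adj gevreyCutoff cube (by simp) hp hC1 hC hΔ
    (m := 1) one_pos hΔm chi1_nonneg (c₀ := 1) one_pos (fun _ _ => le_rfl) (Λ := 1) one_pos
    (fun b _ => ⟨fun φ => φ b, fun φ => φ b, hlin b, hlin b, Or.inl fun _ => rfl, hΛ b, hΛ b⟩) (F := 0) le_rfl hF
    (fun Y hY => absurd hY (notMem_empty Y)) (KY := fun _ => 0) (fun Y hY => absurd hY (notMem_empty Y)) (K₁ := 0) le_rfl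
    (fun Y hY => absurd hY (notMem_empty Y)) (G := 1) hG he he1 (θ := θ) (β' := 1) hθ1 zero_le_one (hes.trans hsθ) hreg' hpre
    (fun Y hY => absurd hY (notMem_empty Y)) hvac hpre₂ hvac₂ hekθ₂ (fun Y hY => absurd hY (notMem_empty Y)) Λ X ht hL γ

end Fin2

end Literature.MathematicalPhysics.QuantumFieldTheory.BalabanImbrieJaffe1984to88.BIJ88Ineq5144TwoCubeLeaf

end
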